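import Mathlib
import Summits.ValiantsHypothesis.ValiantsHypothesis.Theorems.LacunarySymmetroidMatrixDescartesDoorA26WallBubblingBubblingInertiaSpectral

/-!
# The realisable cone is closed (B11, converse and topology) — turnkey helper, val-idea-15

Module of the BUBBLING REDUCTION for obligation (B) `Stmt.stub_bubbling` of the line `Cruxes/DoorA26/Lines/wall_bubbling.lean`
(stmt-ValiantsHypothesis-19979, `Theses.LacunarySymmetroid.DoorA26`).  Contents: `not_twoPos_of_isSymGram`, `not_threeNeg_of_isSymGram`, `isOpen_twoPos`, `isOpen_threeNeg`, `isSymGram_iff`, `isClosed_isSymGram`,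
`polar_eq`, `realisable_iff` (realisable ⇔ `±G` is a symmetroid Gram matrix), `isClosed_realisable`, `realisable_of_tendsto`. [this work]

HONEST FRAMING / PROVENANCE.  Turnkey port of ideator val-idea-15 g1 (crux workfile `Cruxes/DoorA26/Lines/wall_bubbling_Assembly.lean`, commit d4cb61350496, ZERO `sorry`; split into ≤ 400-line modules, one
namespace `…WallBubbling.Bubbling`, single copies of the definitions), filed by prover seat val-port-4 g1 (val-lit port pool; desk g12 RULING #266 (b), director R166/R168) with `--supports stmt-ValiantsHypothesis-19979 --as helper`.
Mathlib-only mathematics (elementary real analysis, linear algebra, finite combinatorics); nothing here bears on `DoorA26` (OPEN; obligations (W), (M), (R) of the line remain),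
on `MatrixDescartes` (stmt-ValiantsHypothesis-18050) or on `VP ≠ VNP`.
-/

-- `Summit.ValiantsHypothesis.ValiantsHypothesis.…` repeats a component by the D-0017 layout
-- (single-conjunct summit), which the `dupNamespace` linter flags; the name is mandated.
set_option linter.dupNamespace false

namespace Summit.ValiantsHypothesis.ValiantsHypothesis.Theorems.LacunarySymmetroidMatrixDescartes.WallBubbling.Bubbling

open Matrix Finset
variable {n : Type*} [Fintype n] [DecidableEq n]

/-! ## The converse: symmetroid Gram shape ⇒ inertia `≤ (1,2)` -/

omit [DecidableEq n] in
/-- Bilinear form of a rank-one matrix. [folklore] -/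
theorem dot_vecMulVec_mulVec (a b z₁ z₂ : n → ℝ) :
    z₁ ⬝ᵥ ((vecMulVec a b) *ᵥ z₂) = (z₁ ⬝ᵥ a) * (z₂ ⬝ᵥ b) := by
  rw [Matrix.vecMulVec_mulVec, op_smul_eq_smul, dotProduct_smul, smul_eq_mul, dotProduct_comm z₂ b]
  ring

omit [DecidableEq n] in
/-- Bilinear form of `v vᵀ − u uᵀ − w wᵀ`. [folklore] -/
theorem symGram_form (v u w z₁ z₂ : n → ℝ) :
    z₁ ⬝ᵥ ((vecMulVec v v - vecMulVec u u - vecMulVec w w) *ᵥ z₂)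
      = (z₁ ⬝ᵥ v) * (z₂ ⬝ᵥ v) - (z₁ ⬝ᵥ u) * (z₂ ⬝ᵥ u) - (z₁ ⬝ᵥ w) * (z₂ ⬝ᵥ w) := by
  simp only [Matrix.sub_mulVec, dotProduct_sub, dot_vecMulVec_mulVec]

omit [DecidableEq n] in
/-- `n₊ ≤ 1` for symmetroid Grams (the tree's `onePositive`, any index type). [folklore] -/
theorem not_twoPos_of_isSymGram {M : Matrix n n ℝ} (hM : IsSymGram M) : ¬ TwoPos M := by
  obtain ⟨v, u, w, rfl⟩ := hM
  rintro ⟨x, y, hx, hy, hxy⟩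
  rw [symGram_form] at hx hy hxy
  set α := x ⬝ᵥ v
  set β := y ⬝ᵥ v
  set p := x ⬝ᵥ u
  set p' := y ⬝ᵥ u
  set s := x ⬝ᵥ w
  set s' := y ⬝ᵥ w
  have hα : 0 < α * α := by nlinarith [mul_self_nonneg p, mul_self_nonneg s]
  have h2 : β * β * (α * α - p * p - s * s) + α * α * (β * β - p' * p' - s' * s')
      = -((β * p - α * p') ^ 2 + (β * s - α * s') ^ 2) := by
    linear_combination (2 * α * β) * hxy
  nlinarith [mul_pos hα hy, mul_nonneg (mul_self_nonneg β) hx.le, sq_nonneg (β * p - α * p'),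
    sq_nonneg (β * s - α * s')]

omit [DecidableEq n] in
/-- `n₋ ≤ 2` for symmetroid Grams: three pairwise orthogonal negative vectors of the form `(+,−,−)` would have a
Gram determinant `n₁ n₂ n₃ < 0`, but that determinant is `det(T)² · det diag(1,−1,−1) ≥ 0`. [folklore] -/
theorem not_threeNeg_of_isSymGram {M : Matrix n n ℝ} (hM : IsSymGram M) : ¬ ThreeNeg M := by
  obtain ⟨v, u, w, rfl⟩ := hM
  rintro ⟨x, y, z, hx, hy, hz, hxy, hxz, hyz⟩
  rw [symGram_form] at hx hy hz hxy hxz hyz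
  set a1 := x ⬝ᵥ v
  set a2 := y ⬝ᵥ v
  set a3 := z ⬝ᵥ v
  set p1 := x ⬝ᵥ u
  set p2 := y ⬝ᵥ u
  set p3 := z ⬝ᵥ u
  set s1 := x ⬝ᵥ w
  set s2 := y ⬝ᵥ w
  set s3 := z ⬝ᵥ w
  set D := a1 * p2 * s3 - a1 * p3 * s2 - a2 * p1 * s3 + a2 * p3 * s1 + a3 * p1 * s2 - a3 * p2 * s1 with hD
  have key : (a1 * a1 - p1 * p1 - s1 * s1) * (a2 * a2 - p2 * p2 - s2 * s2) * (a3 * a3 - p3 * p3 - s3 * s3)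
      - (a1 * a1 - p1 * p1 - s1 * s1) * (a2 * a3 - p2 * p3 - s2 * s3) ^ 2
      - (a2 * a2 - p2 * p2 - s2 * s2) * (a1 * a3 - p1 * p3 - s1 * s3) ^ 2
      - (a3 * a3 - p3 * p3 - s3 * s3) * (a1 * a2 - p1 * p2 - s1 * s2) ^ 2
      + 2 * (a1 * a2 - p1 * p2 - s1 * s2) * (a1 * a3 - p1 * p3 - s1 * s3) * (a2 * a3 - p2 * p3 - s2 * s3)
      = D ^ 2 := by
    rw [hD]; ring
  rw [hxy, hxz, hyz] at key
  have h12 : 0 < (a1 * a1 - p1 * p1 - s1 * s1) * (a2 * a2 - p2 * p2 - s2 * s2) := mul_pos_of_neg_of_neg hx hy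
  have h123 : (a1 * a1 - p1 * p1 - s1 * s1) * (a2 * a2 - p2 * p2 - s2 * s2) * (a3 * a3 - p3 * p3 - s3 * s3) < 0 :=
    mul_neg_of_pos_of_neg h12 hz
  nlinarith [sq_nonneg D]

/-! ## Topology: `TwoPos`, `ThreeNeg` are open; symmetroid Gram shape is closed -/

omit [DecidableEq n] in
/-- Continuity of `M ↦ f(M)ᵀ M g(M)` for continuous vector fields `f, g`. [this work] -/
theorem continuous_form {f g : Matrix n n ℝ → (n → ℝ)} (hf : Continuous f) (hg : Continuous g) :
    Continuous fun M : Matrix n n ℝ => f M ⬝ᵥ (M *ᵥ g M) :=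
  hf.dotProduct (continuous_id.matrix_mulVec hg)

omit [DecidableEq n] in
/-- **`TwoPos` is open** (re-orthogonalise the witness without dividing: `y″ = q(x) y − b(x,y) x`). [folklore] -/
theorem isOpen_twoPos : IsOpen {M : Matrix n n ℝ | TwoPos M} := by
  rw [isOpen_iff_mem_nhds]
  rintro M₀ ⟨x, y, hx, hy, hxy⟩
  -- the moving witness
  let Y : Matrix n n ℝ → (n → ℝ) := fun M => (x ⬝ᵥ (M *ᵥ x)) • y - (x ⬝ᵥ (M *ᵥ y)) • x
  have hYc : Continuous Y :=
    ((continuous_form continuous_const continuous_const).smul continuous_const).sub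
      ((continuous_form continuous_const continuous_const).smul continuous_const)
  let U : Set (Matrix n n ℝ) := {M | 0 < x ⬝ᵥ (M *ᵥ x) ∧ 0 < Y M ⬝ᵥ (M *ᵥ Y M)}
  have hUopen : IsOpen U :=
    (isOpen_lt continuous_const (continuous_form continuous_const continuous_const)).inter
      (isOpen_lt continuous_const (continuous_form hYc hYc))
  have hY₀ : Y M₀ = (x ⬝ᵥ (M₀ *ᵥ x)) • y := by
    simp only [Y, hxy, zero_smul, sub_zero]
  have hM₀U : M₀ ∈ U := by
    refine ⟨hx, ?_⟩
    rw [hY₀, Matrix.mulVec_smul, dotProduct_smul, smul_dotProduct, smul_eq_mul, smul_eq_mul]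
    exact mul_pos hx (mul_pos hx hy)
  refine Filter.mem_of_superset (hUopen.mem_nhds hM₀U) ?_
  rintro M ⟨hMx, hMY⟩
  refine ⟨x, Y M, hMx, hMY, ?_⟩
  simp only [Y, Matrix.mulVec_sub, Matrix.mulVec_smul, dotProduct_sub, dotProduct_smul, smul_eq_mul]
  ring

omit [DecidableEq n] in
/-- **`ThreeNeg` is open** (two-step re-orthogonalisation without dividing). [folklore] -/
theorem isOpen_threeNeg : IsOpen {M : Matrix n n ℝ | ThreeNeg M} := by
  rw [isOpen_iff_mem_nhds]
  rintro M₀ ⟨x, y, z, hx, hy, hz, hxy, hxz, hyz⟩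
  -- abbreviations for the forms
  let q : Matrix n n ℝ → (n → ℝ) → ℝ := fun M a => a ⬝ᵥ (M *ᵥ a)
  let b : Matrix n n ℝ → (n → ℝ) → (n → ℝ) → ℝ := fun M a c => a ⬝ᵥ (M *ᵥ c)
  -- moving witnesses
  let Y : Matrix n n ℝ → (n → ℝ) := fun M => (q M x) • y - (b M x y) • x
  let C : Matrix n n ℝ → ℝ := fun M => -((q M x) * (b M (Y M) z) - (b M x z) * (b M (Y M) x))
  let Z : Matrix n n ℝ → (n → ℝ) := fun M => ((q M x) * (q M (Y M))) • z - ((b M x z) * (q M (Y M))) • x + (C M) • Y M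
  have hq : ∀ a : n → ℝ, Continuous fun M => q M a := fun a => continuous_form continuous_const continuous_const
  have hb : ∀ a c : n → ℝ, Continuous fun M => b M a c := fun a c => continuous_form continuous_const continuous_const
  have hYc : Continuous Y := ((hq x).smul continuous_const).sub ((hb x y).smul continuous_const)
  have hbY : ∀ c : n → ℝ, Continuous fun M => b M (Y M) c := fun c => continuous_form hYc continuous_const
  have hqY : Continuous fun M => q M (Y M) := continuous_form hYc hYc
  have hCc : Continuous C := (((hq x).mul (hbY z)).sub ((hb x z).mul (hbY x))).neg
  have hZc : Continuous Z :=
    ((((hq x).mul hqY).smul continuous_const).sub (((hb x z).mul hqY).smul continuous_const)).add (hCc.smul hYc)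
  let U : Set (Matrix n n ℝ) := {M | q M x < 0 ∧ q M (Y M) < 0 ∧ q M (Z M) < 0}
  have hUopen : IsOpen U :=
    (isOpen_lt (hq x) continuous_const).inter
      ((isOpen_lt hqY continuous_const).inter (isOpen_lt (continuous_form hZc hZc) continuous_const))
  -- values at `M₀`
  have hY₀ : Y M₀ = (q M₀ x) • y := by
    simp only [Y, b, hxy, zero_smul, sub_zero]
  have hqY₀ : q M₀ (Y M₀) = (q M₀ x) * ((q M₀ x) * q M₀ y) := by
    simp only [q, hY₀, Matrix.mulVec_smul, dotProduct_smul, smul_dotProduct, smul_eq_mul]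
  have hbYz₀ : b M₀ (Y M₀) z = 0 := by
    simp only [b, hY₀, smul_dotProduct, smul_eq_mul]
    rw [show y ⬝ᵥ (M₀ *ᵥ z) = 0 from hyz, mul_zero]
  have hC₀ : C M₀ = 0 := by
    simp only [C, hbYz₀, mul_zero, zero_sub, neg_neg]
    rw [show b M₀ x z = 0 from hxz, zero_mul]
  have hZ₀ : Z M₀ = ((q M₀ x) * (q M₀ (Y M₀))) • z := by
    simp only [Z, hC₀, zero_smul, add_zero]
    rw [show b M₀ x z = 0 from hxz, zero_mul, zero_smul, sub_zero]
  have hqx₀ : q M₀ x < 0 := hx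
  have hqY₀neg : q M₀ (Y M₀) < 0 := by
    rw [hqY₀]
    have : 0 < q M₀ x * q M₀ x := mul_pos_of_neg_of_neg hqx₀ hqx₀
    nlinarith [this, hy]
  have hM₀U : M₀ ∈ U := by
    refine ⟨hqx₀, hqY₀neg, ?_⟩
    show Z M₀ ⬝ᵥ (M₀ *ᵥ Z M₀) < 0
    rw [hZ₀, Matrix.mulVec_smul, dotProduct_smul, smul_dotProduct, smul_eq_mul, smul_eq_mul]
    have hApos : 0 < q M₀ x * q M₀ (Y M₀) := mul_pos_of_neg_of_neg hqx₀ hqY₀neg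
    have hA : 0 < (q M₀ x * q M₀ (Y M₀)) * (q M₀ x * q M₀ (Y M₀)) := mul_pos hApos hApos
    have hz' : z ⬝ᵥ (M₀ *ᵥ z) < 0 := hz
    nlinarith [hA, hz']
  refine Filter.mem_of_superset (hUopen.mem_nhds hM₀U) ?_
  rintro M ⟨hMx, hMY, hMZ⟩
  refine ⟨x, Y M, Z M, hMx, hMY, hMZ, ?_, ?_, ?_⟩
  · simp only [Y, q, b, Matrix.mulVec_sub, Matrix.mulVec_smul, dotProduct_sub, dotProduct_smul, smul_eq_mul]
    ring
  · simp only [Z, Y, C, q, b, Matrix.mulVec_sub, Matrix.mulVec_add, Matrix.mulVec_smul, dotProduct_sub,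
      dotProduct_add, dotProduct_smul, smul_eq_mul]
    ring
  · simp only [Z, C, q, b, Matrix.mulVec_sub, Matrix.mulVec_add, Matrix.mulVec_smul, dotProduct_sub,
      dotProduct_add, dotProduct_smul, smul_eq_mul]
    ring

omit [DecidableEq n] in
/-- **B11, characterisation.**  `IsSymGram M ↔ M.IsSymm ∧ ¬ TwoPos M ∧ ¬ ThreeNeg M`. [folklore: Sylvester] -/
theorem isSymGram_iff (M : Matrix n n ℝ) : IsSymGram M ↔ M.IsSymm ∧ ¬ TwoPos M ∧ ¬ ThreeNeg M := by
  constructor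
  · intro h
    refine ⟨?_, not_twoPos_of_isSymGram h, not_threeNeg_of_isSymGram h⟩
    obtain ⟨v, u, w, rfl⟩ := h
    unfold Matrix.IsSymm
    ext a b
    simp only [Matrix.transpose_apply, Matrix.sub_apply, vecMulVec_apply]
    ring
  · rintro ⟨h1, h2, h3⟩
    exact isSymGram_of_inertia M h1 h2 h3

omit [DecidableEq n] in
/-- **B11, closedness.**  The symmetroid Gram cone `{v vᵀ − u uᵀ − w wᵀ}` is closed. [folklore] -/
theorem isClosed_isSymGram : IsClosed {M : Matrix n n ℝ | IsSymGram M} := by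
  have hset : {M : Matrix n n ℝ | IsSymGram M} =
      {M | M.IsSymm} ∩ ({M | TwoPos M}ᶜ ∩ {M | ThreeNeg M}ᶜ) := by
    ext M
    simp only [Set.mem_setOf_eq, Set.mem_inter_iff, Set.mem_compl_iff, isSymGram_iff]
  rw [hset]
  refine IsClosed.inter ?_ (isOpen_twoPos.isClosed_compl.inter isOpen_threeNeg.isClosed_compl)
  have : {M : Matrix n n ℝ | M.IsSymm} = {M | Mᵀ = M} := rfl
  rw [this]
  exact isClosed_eq (continuous_id.matrix_transpose) continuous_id

omit [DecidableEq n] in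
/-- The two-sided cone `{±(v vᵀ − u uᵀ − w wᵀ)}` (the realisable polar Gram matrices of symmetric `2 × 2` pencils,
see `Lines/wall_bubbling.lean` `Realisable`) is closed. [folklore] -/
theorem isClosed_isSymGram_or_neg : IsClosed {M : Matrix n n ℝ | IsSymGram M ∨ IsSymGram (-M)} := by
  have h2 : IsClosed {M : Matrix n n ℝ | IsSymGram (-M)} :=
    isClosed_isSymGram.preimage continuous_neg
  exact isClosed_isSymGram.union h2

/-! ## The letters: realisable polar Gram matrices of symmetric `2 × 2` pencils

`polar` and `Realisable` below are VERBATIM copies (same bodies) of the line file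
`Cruxes/DoorA26/Lines/wall_bubbling.lean` (`…Cruxes.DoorA26.WallBubbling.polar / .Realisable`), so the closedness
statement transfers by `Iff.rfl`-level rewriting once the line file imports this module (or a prover restates it there). -/



/-- The polar form of two symmetric `2 × 2` matrices in the coordinates `v = (a+c)/2, u = (a−c)/2, w = b`:
`polar S T = v_S v_T − u_S u_T − w_S w_T` — i.e. `(Sym₂(ℝ), det) ≅ ℝ^{1,2}`. [folklore] -/
theorem polar_eq (S T : Matrix (Fin 2) (Fin 2) ℝ) (hS : S.IsSymm) (hT : T.IsSymm) :
    polar S T = ((S 0 0 + S 1 1) / 2) * ((T 0 0 + T 1 1) / 2) - ((S 0 0 - S 1 1) / 2) * ((T 0 0 - T 1 1) / 2)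
      - S 0 1 * T 0 1 := by
  have hS10 : S 1 0 = S 0 1 := hS.apply 0 1
  have hT10 : T 1 0 = T 0 1 := hT.apply 0 1
  simp only [polar, Matrix.det_fin_two, Matrix.add_apply, hS10, hT10]
  ring

/-- **Realisable = two-sided symmetroid Gram cone**: `Realisable G ↔ IsSymGram G ∨ IsSymGram (−G)`. [folklore] -/
theorem realisable_iff (G : Matrix (Fin 6) (Fin 6) ℝ) : Realisable G ↔ IsSymGram G ∨ IsSymGram (-G) := by
  constructor
  · rintro ⟨ε, S, hε, hS, hG⟩
    -- the three coordinate vectors of the letters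
    let v : Fin 6 → ℝ := fun l => (S l 0 0 + S l 1 1) / 2
    let u : Fin 6 → ℝ := fun l => (S l 0 0 - S l 1 1) / 2
    let w : Fin 6 → ℝ := fun l => S l 0 1
    have hpol : ∀ i j, polar (S i) (S j) = v i * v j - u i * u j - w i * w j := fun i j =>
      polar_eq (S i) (S j) (hS i) (hS j)
    rcases hε with rfl | rfl
    · left
      refine ⟨v, u, w, ?_⟩
      ext i j
      simp only [Matrix.sub_apply, vecMulVec_apply, hG i j, hpol i j, one_mul]
    · right
      refine ⟨v, u, w, ?_⟩
      ext i j
      simp only [Matrix.neg_apply, Matrix.sub_apply, vecMulVec_apply, hG i j, hpol i j]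
      ring
  · -- from `v, u, w` build the symmetric letters `S l = [[v+u, w],[w, v−u]]`
    have build : ∀ (H : Matrix (Fin 6) (Fin 6) ℝ), IsSymGram H →
        ∃ S : Fin 6 → Matrix (Fin 2) (Fin 2) ℝ, (∀ l, (S l).IsSymm) ∧ ∀ i j, H i j = polar (S i) (S j) := by
      rintro H ⟨v, u, w, rfl⟩
      refine ⟨fun l => !![v l + u l, w l; w l, v l - u l], ?_, ?_⟩
      · intro l
        exact Matrix.IsSymm.ext (by intro i j; fin_cases i <;> fin_cases j <;> rfl)
      · intro i j
        rw [polar_eq _ _ (Matrix.IsSymm.ext (by intro a b; fin_cases a <;> fin_cases b <;> rfl))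
          (Matrix.IsSymm.ext (by intro a b; fin_cases a <;> fin_cases b <;> rfl))]
        simp only [Matrix.sub_apply, vecMulVec_apply, Matrix.of_apply, Matrix.cons_val', Matrix.cons_val_zero,
          Matrix.cons_val_one, Matrix.cons_val_fin_one]
        ring
    rintro (h | h)
    · obtain ⟨S, hS, hH⟩ := build G h
      exact ⟨1, S, Or.inl rfl, hS, fun i j => by rw [one_mul]; exact hH i j⟩
    · obtain ⟨S, hS, hH⟩ := build (-G) h
      refine ⟨-1, S, Or.inr rfl, hS, fun i j => ?_⟩
      have := hH i j
      rw [Matrix.neg_apply] at this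
      linarith

/-- **B11.**  The realisable cone is closed (so blow-up limits of realisable polar Gram matrices stay realisable).
[folklore] -/
theorem isClosed_realisable : IsClosed {G : Matrix (Fin 6) (Fin 6) ℝ | Realisable G} := by
  have : {G : Matrix (Fin 6) (Fin 6) ℝ | Realisable G} = {G | IsSymGram G ∨ IsSymGram (-G)} := by
    ext G; exact realisable_iff G
  rw [this]
  exact isClosed_isSymGram_or_neg

/-- **B11, sequential form** (the shape used in B12): an entrywise limit of realisable matrices is realisable. [this work] -/
theorem realisable_of_tendsto {Gseq : ℕ → Matrix (Fin 6) (Fin 6) ℝ} {G : Matrix (Fin 6) (Fin 6) ℝ}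
    (hreal : ∀ ν, Realisable (Gseq ν)) (hlim : Filter.Tendsto Gseq Filter.atTop (nhds G)) : Realisable G :=
  isClosed_realisable.mem_of_tendsto hlim (Filter.Eventually.of_forall hreal)

end Summit.ValiantsHypothesis.ValiantsHypothesis.Theorems.LacunarySymmetroidMatrixDescartes.WallBubbling.Bubbling
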